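import Summits.QuantumFields.BalabanUV.Beta.FP.TorusStepInsertionSym
import Summits.QuantumFields.BalabanUV.Beta.FP.TorusCompositeCovarianceSym

/-!
# `BalabanUV.Beta.FP.TorusCompositeCovarianceOneSym` — road «FP» for binder row D1, ROUTE T, (β1) RE-BASING (ROW RULING R-D1-g52-1 (3)(c) «the composite
# passes over leaf-06's `compRowsSym`»): **(COV-m) ORDER 1 AT EVERY DEPTH FOR THE (0.4)-SYMMETRISED TOWER, PART 1 — THE SYM COMPOSITE FIRST-ORDER INSERTION
# JET `compIns₁Sym` BY THE CHAIN RULE AND ITS GAUGE-COVARIANCE LAW ON ALL COLUMNS**: `compIns₁Sym … n h · D_finest = compRowsSym … n · Tip(h) −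
# Far_n^{ρ_c}(compRowsSym … n · h)` — the sym twin of leaf-02 g22's C2 `TorusCompositeCovarianceOne` §2 (the `c1 ∕ d1` rows of the `-Sym` door files follow
# in PART 2 by reading this law through the tower generators, as C2-Rows did for the rooted tower)

WHY.  C2 (`TorusCompositeCovarianceOne`) DEFINES the composite first-order insertion jet of the rooted `n`-fold averaging by the chain rule over the one-step
rooted jets `stepIns₁ M Lc (rs 1)` and proves its covariance law on all gauge columns.  The (β1) re-basing replaces every one-step object by its
(0.4)-SYMMETRISED twin at the CENTRED root: rows `QstepSym Lc M ℓ` ∕ `compRowsSym` (leaf-06 G-0), one-step jet `stepIns₁Sym M Lc w` and its law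
`stepIns₁Sym_mul_tgrad` (leaf-02 g30 R-18, `hQ := rfl` at leaf-06's `QstepSym`), composite MASTER identity at the iterated CENTRED roots (leaf-02 g32 R-20
`compRowsSym_mul_tgrad_mul`).  This file is C2 §2 under that substitution, statement by statement.

WHAT (generic `d`; blocking `Lc`, `[NeZero Lc]`; `hc : ctrOff (d+1) Lc ∈ box (d+1) Lc` displayed where a root SITE is read — met by `ctrOff_mem_box`).
* [our object — bookkeeping] **`compIns₁Sym Lc M lev rs n h`** — `0` at depth `0`; at depth `n+1`: `θ_n • stepIns₁Sym M Lc (compRowsSym^{low} · h) ·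
  compRowsSym^{low} + QstepSym Lc M (lev 1) · compIns₁Sym^{low} h`, `θ_n = Lc^{d+1}·stepScale d Lc (lev 1) ∕ σ_n^{low}` — C2's `compIns₁` VERBATIM under
  `stepIns₁ M Lc (rs 1) ↦ stepIns₁Sym M Lc`, `compRows ↦ compRowsSym`, `Qstep Lc M (lev 1) (rs 1) ↦ QstepSym Lc M (lev 1)` (the comb-root list `rs` is
  kept as a parameter, signature-uniform with `compIns₁`; the sym rows and jets ignore it); `compIns₁Sym_zero ∕ _succ ∕ _one` (`rfl` ∕ `rfl` ∕ unfolding).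
* **`compRowsSym_mul_tgrad (hc)`** — THE COMPOSITE SYM MASTER IDENTITY ON ALL COLUMNS (R-20 `compRowsSym_mul_tgrad_mul` at `C := 1`): `compRowsSym … n ·
  D_finest = σ_n • D_M · [s = itRoot n u]`, the iterated root map at the constant CENTRED list `itRoot Lc M (fun _ => ctrOff (d+1) Lc) (fun _ => hc) n`.
* `compIns₁Sym_mul_tgrad_step`, **`compIns₁Sym_mul_tgrad (hc) : ∀ n M lev rs h, compIns₁Sym Lc M lev rs n h · D_finest = compRowsSym … n · Tip(h) −
  Far_n(compRowsSym … n · h)`**, `Tip(h)(b, s) = h b · [s ≡ b.1 + e_{b.2}]`, `Far_n(v)(a, s) = v a · [s = itRoot^{ρ_c} n (a.1 + e_{a.2})]` — C2's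
  `compIns₁_mul_tgrad` VERBATIM with the iterated CENTRED roots.
NOT HERE: PART 2 (`c1 ∕ d1` BY TERM through `towerGen = D_finest · evalN` — the sym twin of C2-Rows `TorusCompositeCovarianceOneRows`); order 2
(`compIns₂Sym ∕ compIns₂₂Sym`, the sym twins of I-4 ∕ TwoPolar over R-19); any chart; any estimate.

[our object — bookkeeping] one def + [folklore] finite sums BY NAME over OUR bookkeeping objects (`compRowsSym ∕ QstepSym ∕ stepIns₁Sym ∕ rootPt ∕ itRoot ∕
tgrad ∕ tdelta ∕ wrapPt`); no `def … : Prop`, nothing cited, 0 sorry, default heartbeats.  Nothing of the dictionary ∕ Bałaban's non-linear averages asserted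
(that the re-based composite's first variation IS this chain rule over the sym one-step tables is the ROW's (β1) ruling R-D1-g52-1 and an2's (C1) TABLE
word, quoted, not adjudicated here); NO chart fixed; the (C1) TABLES, the seven letters, `hH ∕ hQ` untouched.

HONEST DEPENDENCY (page 1, mandatory): continuum YM on T⁴ ⇐ BetaPertH ∧ nine spine estimates (0/9 proved); BetaPertH ⇐ (D1) ∧ (D4) ∧ CAP+tail;
G-an2-4 gates asym, D1 and NE2/3/4.  HONEST FRAMING (cell contract, verbatim): «discharging `BetaPertH` makes Bałaban's UV stability UNCONDITIONAL —
a real constructive-QFT result; it is NOT the continuum limit and NOT the Clay problem.»  ABSOLUTE RULE (cell charter, verbatim): «No internally-minted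
statement may enter as a cited fact. Every hypothesis is either kernel-proved in this package or a verbatim quotation of a PUBLISHED theorem with page
reference. The manuscript(s) under audit are NOT citable for their own disputed steps — they are the thing under adjudication; programme-internal
(2001/route/tribunal) claims are never citable.»  0 estimates; 0∕4 row-D1 binders (hW, hR, D1Tel, D1Rep); NOT (T-ID), NOT (C1), NOT SDF, NOT D1,
NOT BetaPertH, NOT continuum, NOT Clay.  D1 formalisation swarm LEAF PROVER 02 (b2b-balaban-beta-d1-formalise-leaf-02 gen 32), 2026-08-24.  No existing file touched.
-/

noncomputable section

open scoped BigOperators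

namespace Summit.QuantumFields.BalabanUV.Beta.FP.TorusCompositeCovarianceOneSym

open Matrix Finset
open Literature.MathematicalPhysics.QuantumFieldTheory
open Literature.MathematicalPhysics.QuantumFieldTheory.Balaban1983to89
open Literature.MathematicalPhysics.QuantumFieldTheory.Balaban1983to89.Beta
open B5Prop11Plancherel (fine)
open B6Lemma24Torus (pbox mem_pbox)
open AffineAveraging (Site box toSite unitVec)
open AveragingContoursRooted (ctr ctrOff ctrOff_mem_box)
open OneStepResolventKernel (Fib)
open Summit.QuantumFields.BalabanUV.Beta.BorderedHessian (stepScale stepScale_ne_zero)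
open Summit.QuantumFields.BalabanUV.Beta.FP.KernelPeriodisationFib (Idx perF)
open Summit.QuantumFields.BalabanUV.Beta.FP.TorusGaugeCovariance (tdelta tgrad)
open Summit.QuantumFields.BalabanUV.Beta.FP.TorusGaugeCovariancePairing (wrapPt wrapPt_of_mem tdelta_eq_ite_wrapPt sum_tdelta_mul)
open Summit.QuantumFields.BalabanUV.Beta.FP.TorusGaugeCovarianceCoarse (coarsePt)
open Summit.QuantumFields.BalabanUV.Beta.FP.TorusCompositeObjects
open Summit.QuantumFields.BalabanUV.Beta.FP.TorusCompositeObjectsG (QstepSym QSym compRowsSym compRowsSym_succ compRowsSym_one)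
open Summit.QuantumFields.BalabanUV.Beta.FP.TorusCompositeCovariance (rootPt wrapPt_coarsePt_add_add itRoot itRoot_zero itRoot_succ)
open Summit.QuantumFields.BalabanUV.Beta.FP.TorusCompositeCovarianceOne (tdelta_wrapPt of_tdelta_mul prod_stepScale_mul_card_ne_zero')
open Summit.QuantumFields.BalabanUV.Beta.FP.TorusStepInsertionSym (stepIns₁Sym stepIns₁Sym_mul_tgrad)
open Summit.QuantumFields.BalabanUV.Beta.FP.TorusCompositeCovarianceSym (compRowsSym_mul_tgrad_mul)

variable {d : ℕ}

/-! ## §1 The sym tower: the composite first-order insertion jet by the chain rule; its covariance law on all columns -/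

section Tower

variable (Lc : ℕ) [NeZero Lc]

/-- [our object — bookkeeping] **THE COMPOSITE FIRST-ORDER INSERTION JET OF THE (0.4)-SYMMETRISED `n`-FOLD AVERAGING `compRowsSym Lc M lev rs n` ALONG A BOND
WEIGHT `h` ON THE FINEST TORUS, BY THE CHAIN RULE** (push-inside recursion as `compRowsSym`; `lev ∕ rs` indexed from the top, the sym step `M ← fine Lc M` at
level `lev 1`, centred root): `0` at depth `0`; at depth `n+1`: the top step's sym jet `stepIns₁Sym` along the TRANSPORTED direction `compRowsSym^{low} · h`,
weighted by `θ_n = Lc^{d+1}·stepScale d Lc (lev 1) ∕ σ_n^{low}` (`σ_n^{low} = ∏_{i<n} stepScale d Lc (lev (i+2))·#B`), composed with the lower sym composite,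
PLUS the top step's sym rows on the lower jet — C2's `compIns₁` VERBATIM under the (β1) substitution. -/
def compIns₁Sym : (M : Fin (d + 1) → ℕ) → [∀ μ, NeZero (M μ)] → (lev : ℕ → ℕ) → (rs : ℕ → (Fin (d + 1) → ℕ)) → (n : ℕ) →
    ((↥(pbox (towerTorus Lc M n)) × Fin (d + 1) → ℝ)) → Matrix (↥(pbox M) × Fin (d + 1)) (↥(pbox (towerTorus Lc M n)) × Fin (d + 1)) ℝ
  | _, _, _, _, 0, _ => 0
  | M, _, lev, rs, n + 1, h =>
    (((Lc : ℝ) ^ (d + 1) * stepScale d Lc (lev 1)) * (∏ i ∈ range n, (stepScale d Lc (lev (i + 1 + 1)) * ((box (d + 1) Lc).card : ℝ)))⁻¹) •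
        (stepIns₁Sym M Lc ((compRowsSym Lc (fine Lc M) (fun k => lev (k + 1)) (fun k => rs (k + 1)) n) *ᵥ h)
          * compRowsSym Lc (fine Lc M) (fun k => lev (k + 1)) (fun k => rs (k + 1)) n)
      + QstepSym Lc M (lev 1) * compIns₁Sym (fine Lc M) (fun k => lev (k + 1)) (fun k => rs (k + 1)) n h

/-- unfolding, depth `0`. -/
@[simp] theorem compIns₁Sym_zero (M : Fin (d + 1) → ℕ) [∀ μ, NeZero (M μ)] (lev : ℕ → ℕ) (rs : ℕ → (Fin (d + 1) → ℕ)) (h : ↥(pbox M) × Fin (d + 1) → ℝ) :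
    compIns₁Sym Lc M lev rs 0 h = 0 := rfl

/-- unfolding, depth `n+1` — TOP-PEEL BY `rfl` (the chain rule). -/
theorem compIns₁Sym_succ (M : Fin (d + 1) → ℕ) [∀ μ, NeZero (M μ)] (lev : ℕ → ℕ) (rs : ℕ → (Fin (d + 1) → ℕ)) (n : ℕ)
    (h : ↥(pbox (towerTorus Lc (fine Lc M) n)) × Fin (d + 1) → ℝ) :
    compIns₁Sym Lc M lev rs (n + 1) h
      = (((Lc : ℝ) ^ (d + 1) * stepScale d Lc (lev 1)) * (∏ i ∈ range n, (stepScale d Lc (lev (i + 1 + 1)) * ((box (d + 1) Lc).card : ℝ)))⁻¹) •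
          (stepIns₁Sym M Lc ((compRowsSym Lc (fine Lc M) (fun k => lev (k + 1)) (fun k => rs (k + 1)) n) *ᵥ h)
            * compRowsSym Lc (fine Lc M) (fun k => lev (k + 1)) (fun k => rs (k + 1)) n)
        + QstepSym Lc M (lev 1) * compIns₁Sym Lc (fine Lc M) (fun k => lev (k + 1)) (fun k => rs (k + 1)) n h := rfl

/-- the one-fold sym composite jet is the sym one-step jet with `θ_0 = c_{lev 1}⁻¹`: `compIns₁Sym … 1 h = (Lc^{d+1}·stepScale d Lc (lev 1)) • stepIns₁Sym M Lc h`. -/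
theorem compIns₁Sym_one (M : Fin (d + 1) → ℕ) [∀ μ, NeZero (M μ)] (lev : ℕ → ℕ) (rs : ℕ → (Fin (d + 1) → ℕ)) (h : ↥(pbox (fine Lc M)) × Fin (d + 1) → ℝ) :
    compIns₁Sym Lc M lev rs 1 h = ((Lc : ℝ) ^ (d + 1) * stepScale d Lc (lev 1)) • stepIns₁Sym M Lc h := by
  show (((Lc : ℝ) ^ (d + 1) * stepScale d Lc (lev 1)) * (∏ i ∈ range 0, (stepScale d Lc (lev (i + 1 + 1)) * ((box (d + 1) Lc).card : ℝ)))⁻¹) •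
        (stepIns₁Sym M Lc ((1 : Matrix (↥(pbox (fine Lc M)) × Fin (d + 1)) (↥(pbox (fine Lc M)) × Fin (d + 1)) ℝ) *ᵥ h)
          * (1 : Matrix (↥(pbox (fine Lc M)) × Fin (d + 1)) (↥(pbox (fine Lc M)) × Fin (d + 1)) ℝ))
      + QstepSym Lc M (lev 1) * (0 : Matrix (↥(pbox (fine Lc M)) × Fin (d + 1)) (↥(pbox (fine Lc M)) × Fin (d + 1)) ℝ) = _
  rw [Matrix.mul_one, Matrix.one_mulVec, Matrix.mul_zero, add_zero, prod_range_zero, inv_one, mul_one]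

/-- [folklore] **THE COMPOSITE SYM MASTER IDENTITY ON ALL COLUMNS** (R-20 `compRowsSym_mul_tgrad_mul` at `C := 1`): `compRowsSym … n · D_finest = σ_n • D_M ·
[s = itRoot^{ρ_c} n u]`, the iterated root map at the constant CENTRED list, `σ_n = ∏_{i<n} stepScale d Lc (lev (i+1))·#B`. -/
theorem compRowsSym_mul_tgrad (hc : ctrOff (d + 1) Lc ∈ box (d + 1) Lc) (n : ℕ) (M : Fin (d + 1) → ℕ) [∀ μ, NeZero (M μ)] (lev : ℕ → ℕ)
    (rs : ℕ → (Fin (d + 1) → ℕ)) :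
    compRowsSym Lc M lev rs n
        * (tgrad (towerTorus Lc M n)).submatrix
            (fun b : ↥(pbox (towerTorus Lc M n)) × Fin (d + 1) => ((b.1, Sum.inl b.2) : Idx (towerTorus Lc M n) (Fib d))) id
      = (∏ i ∈ range n, (stepScale d Lc (lev (i + 1)) * ((box (d + 1) Lc).card : ℝ))) •
          ((tgrad M).submatrix (fun a : ↥(pbox M) × Fin (d + 1) => ((a.1, Sum.inl a.2) : Idx M (Fib d))) id
            * Matrix.of (fun (u : ↥(pbox M)) (s : ↥(pbox (towerTorus Lc M n))) =>
                tdelta (towerTorus Lc M n) ((itRoot Lc M (fun _ => ctrOff (d + 1) Lc) (fun _ => hc) n u : ↥(pbox (towerTorus Lc M n))) : Site (d + 1)) s)) := by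
  have h1 := compRowsSym_mul_tgrad_mul Lc hc n M lev rs (1 : Matrix ↥(pbox (towerTorus Lc M n)) ↥(pbox (towerTorus Lc M n)) ℝ)
  rw [Matrix.mul_one] at h1
  rw [h1]
  congr 2
  ext u s
  simp only [Matrix.submatrix_apply, Matrix.of_apply, id, Matrix.one_apply, tdelta_eq_ite_wrapPt, wrapPt_of_mem]
  by_cases hu : itRoot Lc M (fun _ => ctrOff (d + 1) Lc) (fun _ => hc) n u = s <;> simp [hu]

/-- [folklore] **(COV-m) ORDER 1 FOR THE SYM TOWER, THE INDUCTION STEP** (top peel; stated in the tower's push-inside types — `compIns₁Sym … (n+1)`,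
`compRowsSym … (n+1)`, `itRoot … (n+1)` UNFOLDED by `rfl`): the chain rule's two summands against the finest gradient — the top step's sym jet along the
transported direction meets the COMPOSITE sym MASTER identity (`compRowsSym_mul_tgrad`) and then the ONE-STEP sym law (R-18 `stepIns₁Sym_mul_tgrad` at
`Q := QstepSym Lc M (lev 1)`, `hQ := rfl`), whose tip contact CANCELS the lower law's far-root contact (this is what fixes `θ_n`) and whose far-root contact is
the new one; the top sym rows carry the lower law's tip term to the composite tip term.  C2's `compIns₁_mul_tgrad_step` VERBATIM under the substitution. -/
theorem compIns₁Sym_mul_tgrad_step (hc : ctrOff (d + 1) Lc ∈ box (d + 1) Lc) (n : ℕ) (M : Fin (d + 1) → ℕ) [∀ μ, NeZero (M μ)] (lev : ℕ → ℕ)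
    (rs : ℕ → (Fin (d + 1) → ℕ)) (h : ↥(pbox (towerTorus Lc (fine Lc M) n)) × Fin (d + 1) → ℝ)
    (ih : compIns₁Sym Lc (fine Lc M) (fun k => lev (k + 1)) (fun k => rs (k + 1)) n h
        * (tgrad (towerTorus Lc (fine Lc M) n)).submatrix
            (fun b : ↥(pbox (towerTorus Lc (fine Lc M) n)) × Fin (d + 1) => ((b.1, Sum.inl b.2) : Idx (towerTorus Lc (fine Lc M) n) (Fib d))) id
      = compRowsSym Lc (fine Lc M) (fun k => lev (k + 1)) (fun k => rs (k + 1)) n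
            * Matrix.of (fun (b : ↥(pbox (towerTorus Lc (fine Lc M) n)) × Fin (d + 1)) (s : ↥(pbox (towerTorus Lc (fine Lc M) n))) =>
                h b * tdelta (towerTorus Lc (fine Lc M) n) ((b.1 : Site (d + 1)) + unitVec b.2) s)
          - Matrix.of (fun (a : ↥(pbox (fine Lc M)) × Fin (d + 1)) (s : ↥(pbox (towerTorus Lc (fine Lc M) n))) =>
              (compRowsSym Lc (fine Lc M) (fun k => lev (k + 1)) (fun k => rs (k + 1)) n *ᵥ h) a
                * tdelta (towerTorus Lc (fine Lc M) n)
                    ((itRoot Lc (fine Lc M) (fun _ => ctrOff (d + 1) Lc) (fun _ => hc) n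
                        (wrapPt (fine Lc M) ((a.1 : Site (d + 1)) + unitVec a.2)) : ↥(pbox (towerTorus Lc (fine Lc M) n))) : Site (d + 1)) s)) :
    ((((Lc : ℝ) ^ (d + 1) * stepScale d Lc (lev 1)) * (∏ i ∈ range n, (stepScale d Lc (lev (i + 1 + 1)) * ((box (d + 1) Lc).card : ℝ)))⁻¹) •
          (stepIns₁Sym M Lc ((compRowsSym Lc (fine Lc M) (fun k => lev (k + 1)) (fun k => rs (k + 1)) n) *ᵥ h)
            * compRowsSym Lc (fine Lc M) (fun k => lev (k + 1)) (fun k => rs (k + 1)) n)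
        + QstepSym Lc M (lev 1) * compIns₁Sym Lc (fine Lc M) (fun k => lev (k + 1)) (fun k => rs (k + 1)) n h)
        * (tgrad (towerTorus Lc (fine Lc M) n)).submatrix
            (fun b : ↥(pbox (towerTorus Lc (fine Lc M) n)) × Fin (d + 1) => ((b.1, Sum.inl b.2) : Idx (towerTorus Lc (fine Lc M) n) (Fib d))) id
      = QstepSym Lc M (lev 1) * compRowsSym Lc (fine Lc M) (fun k => lev (k + 1)) (fun k => rs (k + 1)) n
            * Matrix.of (fun (b : ↥(pbox (towerTorus Lc (fine Lc M) n)) × Fin (d + 1)) (s : ↥(pbox (towerTorus Lc (fine Lc M) n))) =>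
                h b * tdelta (towerTorus Lc (fine Lc M) n) ((b.1 : Site (d + 1)) + unitVec b.2) s)
          - Matrix.of (fun (a : ↥(pbox M) × Fin (d + 1)) (s : ↥(pbox (towerTorus Lc (fine Lc M) n))) =>
              ((QstepSym Lc M (lev 1) * compRowsSym Lc (fine Lc M) (fun k => lev (k + 1)) (fun k => rs (k + 1)) n) *ᵥ h) a
                * tdelta (towerTorus Lc (fine Lc M) n)
                    ((itRoot Lc (fine Lc M) (fun _ => ctrOff (d + 1) Lc) (fun _ => hc) n
                        (rootPt M Lc hc (wrapPt M ((a.1 : Site (d + 1)) + unitVec a.2))) : ↥(pbox (towerTorus Lc (fine Lc M) n))) : Site (d + 1)) s) := by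
  have hB : (box (d + 1) Lc).Nonempty := ⟨ctrOff (d + 1) Lc, hc⟩
  have hθ : ((Lc : ℝ) ^ (d + 1) * stepScale d Lc (lev 1)) * (∏ i ∈ range n, (stepScale d Lc (lev (i + 1 + 1)) * ((box (d + 1) Lc).card : ℝ)))⁻¹
      * (∏ i ∈ range n, (stepScale d Lc (lev (i + 1 + 1)) * ((box (d + 1) Lc).card : ℝ))) * ((Lc : ℝ) ^ (d + 1) * stepScale d Lc (lev 1))⁻¹ = 1 := by
    rw [inv_mul_cancel_right₀ (prod_stepScale_mul_card_ne_zero' Lc hB (fun i => lev (i + 1 + 1)) n),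
      mul_inv_cancel₀ (mul_ne_zero (pow_ne_zero _ (by exact_mod_cast NeZero.ne Lc)) (stepScale_ne_zero _))]
  -- the two contact compositions through the lower tower's iterated-root indicator (`of_tdelta_mul`)
  have tipR : QstepSym Lc M (lev 1)
        * Matrix.of (fun (b : ↥(pbox (fine Lc M)) × Fin (d + 1)) (t : ↥(pbox (fine Lc M))) =>
            (compRowsSym Lc (fine Lc M) (fun k => lev (k + 1)) (fun k => rs (k + 1)) n *ᵥ h) b * tdelta (fine Lc M) ((b.1 : Site (d + 1)) + unitVec b.2) t)
        * Matrix.of (fun (u : ↥(pbox (fine Lc M))) (s : ↥(pbox (towerTorus Lc (fine Lc M) n))) =>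
            tdelta (towerTorus Lc (fine Lc M) n)
              ((itRoot Lc (fine Lc M) (fun _ => ctrOff (d + 1) Lc) (fun _ => hc) n u : ↥(pbox (towerTorus Lc (fine Lc M) n))) : Site (d + 1)) s)
      = QstepSym Lc M (lev 1)
          * Matrix.of (fun (a : ↥(pbox (fine Lc M)) × Fin (d + 1)) (s : ↥(pbox (towerTorus Lc (fine Lc M) n))) =>
              (compRowsSym Lc (fine Lc M) (fun k => lev (k + 1)) (fun k => rs (k + 1)) n *ᵥ h) a
                * tdelta (towerTorus Lc (fine Lc M) n)
                    ((itRoot Lc (fine Lc M) (fun _ => ctrOff (d + 1) Lc) (fun _ => hc) n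
                        (wrapPt (fine Lc M) ((a.1 : Site (d + 1)) + unitVec a.2)) : ↥(pbox (towerTorus Lc (fine Lc M) n))) : Site (d + 1)) s) := by
    rw [Matrix.mul_assoc, of_tdelta_mul (fine Lc M)]
    congr 1
  have farR : Matrix.of (fun (a : ↥(pbox M) × Fin (d + 1)) (t : ↥(pbox (fine Lc M))) =>
        (QstepSym Lc M (lev 1) *ᵥ (compRowsSym Lc (fine Lc M) (fun k => lev (k + 1)) (fun k => rs (k + 1)) n *ᵥ h)) a
          * tdelta (fine Lc M) ((rootPt M Lc hc (wrapPt M ((a.1 : Site (d + 1)) + unitVec a.2)) : ↥(pbox (fine Lc M))) : Site (d + 1)) t)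
        * Matrix.of (fun (u : ↥(pbox (fine Lc M))) (s : ↥(pbox (towerTorus Lc (fine Lc M) n))) =>
            tdelta (towerTorus Lc (fine Lc M) n)
              ((itRoot Lc (fine Lc M) (fun _ => ctrOff (d + 1) Lc) (fun _ => hc) n u : ↥(pbox (towerTorus Lc (fine Lc M) n))) : Site (d + 1)) s)
      = Matrix.of (fun (a : ↥(pbox M) × Fin (d + 1)) (s : ↥(pbox (towerTorus Lc (fine Lc M) n))) =>
          ((QstepSym Lc M (lev 1) * compRowsSym Lc (fine Lc M) (fun k => lev (k + 1)) (fun k => rs (k + 1)) n) *ᵥ h) a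
            * tdelta (towerTorus Lc (fine Lc M) n)
                ((itRoot Lc (fine Lc M) (fun _ => ctrOff (d + 1) Lc) (fun _ => hc) n
                    (rootPt M Lc hc (wrapPt M ((a.1 : Site (d + 1)) + unitVec a.2))) : ↥(pbox (towerTorus Lc (fine Lc M) n))) : Site (d + 1)) s) := by
    rw [of_tdelta_mul (fine Lc M)]
    ext a s
    simp only [Matrix.of_apply, wrapPt_of_mem, Matrix.mulVec_mulVec]
  rw [Matrix.add_mul, Matrix.smul_mul, Matrix.mul_assoc, Matrix.mul_assoc, compRowsSym_mul_tgrad Lc hc n (fine Lc M), ih,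
    Matrix.mul_smul, ← Matrix.mul_assoc, stepIns₁Sym_mul_tgrad M Lc hc (lev 1) (Q := QstepSym Lc M (lev 1)) rfl, Matrix.smul_mul, Matrix.sub_mul,
    tipR, farR, smul_smul, smul_smul, hθ, one_smul, Matrix.mul_sub, ← Matrix.mul_assoc]
  abel

/-- [folklore] **`compIns₁Sym_mul_tgrad` — (COV-m) ORDER 1 FOR THE SYM TOWER: THE COMPOSITE SYM FIRST-ORDER INSERTION JET's GAUGE-COVARIANCE LAW ON ALL
COLUMNS, AT EVERY DEPTH**: `compIns₁Sym … n h · D_finest = compRowsSym … n · Tip(h) − Far_n(compRowsSym … n · h)` — `Tip(h)(b, s) = h b · [s ≡ b.1 +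
e_{b.2}]` (the tip contact on the finest torus), `Far_n(v)(a, s) = v a · [s = itRoot^{ρ_c} n (a.1 + e_{a.2})]` (the contact at the ITERATED CENTRED ROOT of the
far endpoint of the top bond `a`).  Depth `0`: both sides vanish; the step is `compIns₁Sym_mul_tgrad_step`. -/
theorem compIns₁Sym_mul_tgrad (hc : ctrOff (d + 1) Lc ∈ box (d + 1) Lc) :
    ∀ (n : ℕ) (M : Fin (d + 1) → ℕ) [∀ μ, NeZero (M μ)] (lev : ℕ → ℕ) (rs : ℕ → (Fin (d + 1) → ℕ))
      (h : ↥(pbox (towerTorus Lc M n)) × Fin (d + 1) → ℝ),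
      compIns₁Sym Lc M lev rs n h
          * (tgrad (towerTorus Lc M n)).submatrix
              (fun b : ↥(pbox (towerTorus Lc M n)) × Fin (d + 1) => ((b.1, Sum.inl b.2) : Idx (towerTorus Lc M n) (Fib d))) id
        = compRowsSym Lc M lev rs n
              * Matrix.of (fun (b : ↥(pbox (towerTorus Lc M n)) × Fin (d + 1)) (s : ↥(pbox (towerTorus Lc M n))) =>
                  h b * tdelta (towerTorus Lc M n) ((b.1 : Site (d + 1)) + unitVec b.2) s)
            - Matrix.of (fun (a : ↥(pbox M) × Fin (d + 1)) (s : ↥(pbox (towerTorus Lc M n))) =>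
                (compRowsSym Lc M lev rs n *ᵥ h) a
                  * tdelta (towerTorus Lc M n)
                      ((itRoot Lc M (fun _ => ctrOff (d + 1) Lc) (fun _ => hc) n (wrapPt M ((a.1 : Site (d + 1)) + unitVec a.2)) : ↥(pbox (towerTorus Lc M n))) : Site (d + 1)) s)
  | 0, M, _, lev, rs, h => by
    show (0 : Matrix (↥(pbox M) × Fin (d + 1)) (↥(pbox M) × Fin (d + 1)) ℝ)
          * (tgrad M).submatrix (fun b : ↥(pbox M) × Fin (d + 1) => ((b.1, Sum.inl b.2) : Idx M (Fib d))) id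
        = (1 : Matrix (↥(pbox M) × Fin (d + 1)) (↥(pbox M) × Fin (d + 1)) ℝ)
              * Matrix.of (fun (b : ↥(pbox M) × Fin (d + 1)) (s : ↥(pbox M)) => h b * tdelta M ((b.1 : Site (d + 1)) + unitVec b.2) s)
            - Matrix.of (fun (a : ↥(pbox M) × Fin (d + 1)) (s : ↥(pbox M)) =>
                ((1 : Matrix (↥(pbox M) × Fin (d + 1)) (↥(pbox M) × Fin (d + 1)) ℝ) *ᵥ h) a
                  * tdelta M ((wrapPt M ((a.1 : Site (d + 1)) + unitVec a.2) : ↥(pbox M)) : Site (d + 1)) s)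
    rw [Matrix.zero_mul, Matrix.one_mul, Matrix.one_mulVec, eq_comm, sub_eq_zero]
    ext a s
    rw [Matrix.of_apply, Matrix.of_apply, tdelta_wrapPt]
  | n + 1, M, _, lev, rs, h =>
    compIns₁Sym_mul_tgrad_step Lc hc n M lev rs h (compIns₁Sym_mul_tgrad hc n (fine Lc M) (fun k => lev (k + 1)) (fun k => rs (k + 1)) h)

end Tower

end Summit.QuantumFields.BalabanUV.Beta.FP.TorusCompositeCovarianceOneSym

end
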